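import Mathlib
import HarnessLib
import Literature.Combinatorics.Enumerative.EntropyBregmanLogSum
import Literature.Combinatorics.Enumerative.EntropyBregmanOrderAverage
import Literature.Combinatorics.Enumerative.EntropyBregmanGibbsStep
import Literature.Combinatorics.Enumerative.EntropyBregmanChainRule

/-!
# The entropy form of Brégman's inequality (Cuckler–Kahn's "−1 nat per vertex")

Let `X` be a nonempty finite set of permutations of `Fin n`, `N = #X`, and for a row `i` and a column
`j` let `c i j = #{σ ∈ X : σ i = j}`, so that `j ↦ c i j / N` is the law of `σ i` for `σ` uniform on
`X` (the `i`-th *marginal*), with Shannon entropy `H_i = ∑_j negMulLog (c i j / N)`.  Brégman's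
theorem (`BregmanMinc.lean`) bounds `log N` by the row SUPPORT sizes; the entropy form proved here
bounds it by the row ENTROPIES:

* `factorial_mul_card_mul_log_card_le_entropy_add_log_avail` — the averaged chain rule with Gibbs'
  inequality: `n!·N·log N ≤ n!·N·∑_i H_i + ∑_i ∑_{σ ∈ X} ∑_τ log (available mass)`, where for an
  order `τ` of the rows the *available mass* of row `i` at `σ` is the marginal mass of row `i` on the
  columns `σ i'` of the rows `i'` not revealed before `i` (`τ⁻¹ i ≤ τ⁻¹ i'`);
* `log_card_le_sum_negMulLog_sub` — **the entropy Brégman inequality**: if every marginal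
  probability is at most `η`, `0 < η < 1`, and `n ≥ 2`, then
  `log N ≤ ∑_i H_i − (n − 1)·(1 − 4√η)`;
* `exists_spread_log_card_add_kl_le` — the Cuckler–Kahn form with Stirling folded in: for every
  `δ > 0` there are `η > 0` and `n₀` such that every nonempty `η`-spread `X ⊆ S_n`, `n ≥ n₀`, has
  `log N + ∑_i (log n − H_i) ≤ log n! + δ·n` — one nat per row better than the trivial
  `log N ≤ ∑_i H_i`, i.e. the total Kullback–Leibler divergence of the marginals from uniform is paid
  for by the size of `X` up to `δ n`.

This is, for bipartite perfect matchings (= permutations) and the uniform measure on `X`, the entropy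
bound of Cuckler and Kahn [CucklerKahn2009] (`h(σ) ≤ ∑_i H(σ i) − n + o(n)` as the marginals spread),
which refines Radhakrishnan's entropy proof of Brégman's theorem [Radhakrishnan1997].

Proof (assembled from the four files imported above).  The chain rule summed over all orders
(`factorial_mul_card_mul_log_card_eq_sum_chain`) writes `n!·N·log N` as a triple sum of log-ratios of
fibre sizes; the Gibbs step (`sum_log_fibre_ratio_le_entropy_add_log_avail`) bounds each `(i, τ)` slice
by `N·H_i` plus the sum over `σ` of the logarithm of the available mass; the random-order average
(`sum_perm_log_avail_symm_le`: position of `i` uniform, Jensen inside each position class) bounds the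
`τ`-sum for fixed `(i, σ)` by `(n−1)!·∑_{k<n} log (w + (1−w) k/(n−1))` with `w = c i (σ i) / N ≤ η`, and
the logarithmic Riemann sum (`sum_log_affine_le`, `∫₀¹ log u du = −1`) by `(n−1)(4√w − 1)`.

References: B. Cuckler, J. Kahn, Entropy bounds for perfect matchings and Hamiltonian cycles,
*Combinatorica* 29 (2009) 327–335 [CucklerKahn2009]; J. Radhakrishnan, An entropy proof of Bregman's
theorem, *J. Combin. Theory Ser. A* 77 (1997) 161–164 [Radhakrishnan1997].  Deliberately not here:
non-uniform measures on `X`, general (non-bipartite) graphs and Hamiltonian cycles (the rest of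
[CucklerKahn2009]), and the sharp error term `w log(1/w)/(1−w)` (available from `sum_log_affine_le_sharp`).
-/

namespace Literature.Combinatorics.Enumerative

open Finset

variable {n : ℕ}

/-! ### The available mass, reindexed by rows -/

/-- Reindexing the available mass by rows: for an order `τ`, a permutation `σ` and a row `i`, the
columns `j` not among the values `σ i'` of the rows `i'` revealed before `i` are exactly the values
`σ i'` of the rows `i'` with `τ⁻¹ i ≤ τ⁻¹ i'`. [folklore] -/
theorem sum_filter_avail_eq_sum_filter_symm_le (X : Finset (Equiv.Perm (Fin n))) (i : Fin n)
    (τ σ : Equiv.Perm (Fin n))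
    [DecidablePred (fun j : Fin n => ∀ i' ∈ Finset.univ.filter (fun i' => τ.symm i' < τ.symm i),
      σ i' ≠ j)] :
    ∑ j ∈ Finset.univ.filter (fun j => ∀ i' ∈ Finset.univ.filter (fun i' => τ.symm i' < τ.symm i),
        σ i' ≠ j), ((X.filter (fun σ' => σ' i = j)).card : ℝ) / (X.card : ℝ) =
      ∑ i' ∈ Finset.univ.filter (fun i' => τ.symm i ≤ τ.symm i'),
        ((X.filter (fun σ' => σ' i = σ i')).card : ℝ) / (X.card : ℝ) := by
  have hset : Finset.univ.filter (fun j => ∀ i' ∈ Finset.univ.filter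
      (fun i' => τ.symm i' < τ.symm i), σ i' ≠ j) =
      (Finset.univ.filter (fun i' => τ.symm i ≤ τ.symm i')).image σ := by
    ext j
    simp only [Finset.mem_filter, Finset.mem_univ, true_and, Finset.mem_image]
    constructor
    · intro h
      refine ⟨σ.symm j, ?_, by simp⟩
      by_contra hlt
      push Not at hlt
      exact h (σ.symm j) hlt (by simp)
    · rintro ⟨i', hi', rfl⟩ i'' hi'' heq
      have : i'' = i' := σ.injective heq
      subst this
      exact absurd hi'' (not_lt.2 hi')
  rw [hset, Finset.sum_image (fun a _ b _ h => σ.injective h)]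

/-! ### The averaged chain rule with Gibbs' inequality -/

/-- **Chain rule + Gibbs, averaged over all orders.**  For a nonempty finite set `X` of permutations
of `Fin n` with `N = #X` and `c i j = #{σ' ∈ X : σ' i = j}`:
`n!·N·log N ≤ n!·N·∑_i ∑_j negMulLog (c i j / N) + ∑_i ∑_{σ ∈ X} ∑_τ log (∑_{i' : τ⁻¹ i ≤ τ⁻¹ i'} c i (σ i') / N)`
— in entropy language `H(σ) = 𝔼_τ ∑_i H(σ_i ∣ σ_{B(τ,i)}) ≤ ∑_i H(σ_i) + ∑_i 𝔼_{τ,σ} log P_{τ,i}(σ)`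
for `σ` uniform on `X`, `P` the available mass. [cite: CucklerKahn2009, §2 (bipartite case)] -/
theorem factorial_mul_card_mul_log_card_le_entropy_add_log_avail (X : Finset (Equiv.Perm (Fin n)))
    (hX : X.Nonempty) :
    ((n.factorial : ℝ) * (X.card : ℝ)) * Real.log (X.card : ℝ) ≤
      ((n.factorial : ℝ) * (X.card : ℝ)) *
          ∑ i : Fin n, ∑ j : Fin n,
            Real.negMulLog (((X.filter (fun σ => σ i = j)).card : ℝ) / (X.card : ℝ)) +
        ∑ i : Fin n, ∑ σ ∈ X, ∑ τ : Equiv.Perm (Fin n),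
          Real.log (∑ i' ∈ Finset.univ.filter (fun i' => τ.symm i ≤ τ.symm i'),
            ((X.filter (fun σ' => σ' i = σ i')).card : ℝ) / (X.card : ℝ)) := by
  rw [factorial_mul_card_mul_log_card_eq_sum_chain X]
  have hstep : ∀ (i : Fin n) (τ : Equiv.Perm (Fin n)),
      ∑ σ ∈ X, (Real.log ((X.filter (fun σ' => ∀ i' ∈ Finset.univ.filter
          (fun i' => τ.symm i' < τ.symm i), σ' i' = σ i')).card : ℝ) -
        Real.log ((X.filter (fun σ' => (∀ i' ∈ Finset.univ.filter
          (fun i' => τ.symm i' < τ.symm i), σ' i' = σ i') ∧ σ' i = σ i)).card : ℝ)) ≤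
      (X.card : ℝ) * ∑ j : Fin n,
          Real.negMulLog (((X.filter (fun σ' => σ' i = j)).card : ℝ) / (X.card : ℝ)) +
      ∑ σ ∈ X, Real.log (∑ i' ∈ Finset.univ.filter (fun i' => τ.symm i ≤ τ.symm i'),
          ((X.filter (fun σ' => σ' i = σ i')).card : ℝ) / (X.card : ℝ)) := by
    intro i τ
    have h := sum_log_fibre_ratio_le_entropy_add_log_avail X i
      (Finset.univ.filter (fun i' => τ.symm i' < τ.symm i)) hX (by simp)
    simp only [sum_filter_avail_eq_sum_filter_symm_le] at h
    convert h using 7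
  calc _ ≤ ∑ i : Fin n, ∑ τ : Equiv.Perm (Fin n),
        ((X.card : ℝ) * ∑ j : Fin n,
            Real.negMulLog (((X.filter (fun σ' => σ' i = j)).card : ℝ) / (X.card : ℝ)) +
          ∑ σ ∈ X, Real.log (∑ i' ∈ Finset.univ.filter (fun i' => τ.symm i ≤ τ.symm i'),
            ((X.filter (fun σ' => σ' i = σ i')).card : ℝ) / (X.card : ℝ))) :=
        Finset.sum_le_sum fun i _ => Finset.sum_le_sum fun τ _ => hstep i τ
    _ = _ := by
        have hperm : (Fintype.card (Equiv.Perm (Fin n)) : ℝ) = (n.factorial : ℝ) := by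
          rw [Fintype.card_perm, Fintype.card_fin]
        simp only [Finset.sum_add_distrib, Finset.sum_const, Finset.card_univ, nsmul_eq_mul]
        rw [hperm]
        congr 1
        · rw [Finset.mul_sum]
          refine Finset.sum_congr rfl fun i _ => ?_
          ring
        · refine Finset.sum_congr rfl fun i _ => ?_
          rw [Finset.sum_comm]

/-! ### The entropy Brégman inequality -/

/-- The fibres `{σ ∈ X : σ i = j}`, `j ∈ Fin n`, partition `X`: `∑_j c i j = #X`. [folklore] -/
theorem sum_card_filter_apply_eq_card (X : Finset (Equiv.Perm (Fin n))) (i : Fin n) :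
    ∑ j : Fin n, ((X.filter (fun σ => σ i = j)).card : ℝ) = (X.card : ℝ) := by
  have h := Finset.card_eq_sum_card_fiberwise (f := fun σ : Equiv.Perm (Fin n) => σ i) (s := X)
    (t := Finset.univ) (fun _ _ => Finset.mem_univ _)
  rw [h]
  push_cast
  rfl

/-- **The entropy Brégman inequality** (Cuckler–Kahn's "−1 nat per vertex", uniform measure on a
set of permutations).  If `n ≥ 2`, `X` is a nonempty finite set of permutations of `Fin n` with
`N = #X`, `c i j = #{σ ∈ X : σ i = j}`, and every marginal probability satisfies `c i j / N ≤ η` for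
some `0 < η < 1`, then
`log N ≤ ∑_i ∑_j negMulLog (c i j / N) − (n − 1) + (n − 1)·4√η`,
i.e. `H(σ) ≤ ∑_i H(σ i) − (n−1)(1 − 4√η)` for `σ` uniform on `X`.
[cite: CucklerKahn2009, §1 (main theorem, bipartite case)] -/
theorem log_card_le_sum_negMulLog_sub (hn : 2 ≤ n) {η : ℝ} (hη0 : 0 < η) (hη1 : η < 1)
    (X : Finset (Equiv.Perm (Fin n))) (hX : X.Nonempty)
    (hsp : ∀ i j : Fin n, ((X.filter (fun σ => σ i = j)).card : ℝ) / (X.card : ℝ) ≤ η) :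
    Real.log (X.card : ℝ) ≤
      ∑ i : Fin n, ∑ j : Fin n,
          Real.negMulLog (((X.filter (fun σ => σ i = j)).card : ℝ) / (X.card : ℝ)) -
        ((n : ℝ) - 1) + ((n : ℝ) - 1) * (4 * Real.sqrt η) := by
  have hN : (0 : ℝ) < X.card := by exact_mod_cast hX.card_pos
  have hF : (0 : ℝ) < n.factorial := by exact_mod_cast n.factorial_pos
  have hn1 : (0 : ℝ) ≤ (n : ℝ) - 1 := by
    have : (2 : ℝ) ≤ n := by exact_mod_cast hn
    linarith
  have hC := factorial_mul_card_mul_log_card_le_entropy_add_log_avail X hX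
  -- the per-`(i,σ)` bound from the order average and the logarithmic Riemann sum
  have key : ∀ i : Fin n, ∀ σ ∈ X,
      ∑ τ : Equiv.Perm (Fin n),
          Real.log (∑ i' ∈ Finset.univ.filter (fun i' => τ.symm i ≤ τ.symm i'),
            ((X.filter (fun σ' => σ' i = σ i')).card : ℝ) / (X.card : ℝ)) ≤
        ((n - 1).factorial : ℝ) * (((n : ℝ) - 1) * (4 * Real.sqrt η - 1)) := by
    intro i σ hσ
    have hw0 : ∀ i' : Fin n,
        (0 : ℝ) ≤ ((X.filter (fun σ' => σ' i = σ i')).card : ℝ) / (X.card : ℝ) :=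
      fun i' => div_nonneg (Nat.cast_nonneg _) hN.le
    have hre : ∑ i' : Fin n, ((X.filter (fun σ' => σ' i = σ i')).card : ℝ) =
        ∑ j : Fin n, ((X.filter (fun σ' => σ' i = j)).card : ℝ) := by
      rw [← Equiv.sum_comp σ (fun j => ((X.filter (fun σ' => σ' i = j)).card : ℝ))]
    have hw1 : ∑ i' : Fin n, ((X.filter (fun σ' => σ' i = σ i')).card : ℝ) / (X.card : ℝ) = 1 := by
      rw [← Finset.sum_div, hre, sum_card_filter_apply_eq_card, div_self hN.ne']
    have hwi : (0 : ℝ) < ((X.filter (fun σ' => σ' i = σ i)).card : ℝ) / (X.card : ℝ) := by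
      have hmem : σ ∈ X.filter (fun σ' => σ' i = σ i) := Finset.mem_filter.2 ⟨hσ, rfl⟩
      have : (0 : ℝ) < (X.filter (fun σ' => σ' i = σ i)).card := by
        exact_mod_cast Finset.card_pos.2 ⟨σ, hmem⟩
      exact div_pos this hN
    have hspi : ((X.filter (fun σ' => σ' i = σ i)).card : ℝ) / (X.card : ℝ) ≤ η := hsp i (σ i)
    have hwi1 : ((X.filter (fun σ' => σ' i = σ i)).card : ℝ) / (X.card : ℝ) < 1 :=
      lt_of_le_of_lt hspi hη1
    have hB := sum_perm_log_avail_symm_le n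
      (fun i' => ((X.filter (fun σ' => σ' i = σ i')).card : ℝ) / (X.card : ℝ)) i hw0 hw1 hwi
    have hA := sum_log_affine_le n hn _ hwi hwi1
    have hmono : 4 * Real.sqrt (((X.filter (fun σ' => σ' i = σ i)).card : ℝ) / (X.card : ℝ)) - 1 ≤
        4 * Real.sqrt η - 1 := by
      have := Real.sqrt_le_sqrt hspi
      linarith
    have hfac0 : (0 : ℝ) ≤ ((n - 1).factorial : ℝ) := Nat.cast_nonneg _
    calc _ ≤ _ := hB
      _ ≤ ((n - 1).factorial : ℝ) * (((n : ℝ) - 1) *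
            (4 * Real.sqrt (((X.filter (fun σ' => σ' i = σ i)).card : ℝ) / (X.card : ℝ)) - 1)) :=
          mul_le_mul_of_nonneg_left hA hfac0
      _ ≤ ((n - 1).factorial : ℝ) * (((n : ℝ) - 1) * (4 * Real.sqrt η - 1)) :=
          mul_le_mul_of_nonneg_left (mul_le_mul_of_nonneg_left hmono hn1) hfac0
  -- sum over `σ` and `i`
  have hsum : ∑ i : Fin n, ∑ σ ∈ X, ∑ τ : Equiv.Perm (Fin n),
      Real.log (∑ i' ∈ Finset.univ.filter (fun i' => τ.symm i ≤ τ.symm i'),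
        ((X.filter (fun σ' => σ' i = σ i')).card : ℝ) / (X.card : ℝ)) ≤
      (n : ℝ) * ((X.card : ℝ) * (((n - 1).factorial : ℝ) * (((n : ℝ) - 1) * (4 * Real.sqrt η - 1)))) := by
    calc _ ≤ ∑ _i : Fin n, ∑ _σ ∈ X, ((n - 1).factorial : ℝ) * (((n : ℝ) - 1) * (4 * Real.sqrt η - 1)) :=
          Finset.sum_le_sum fun i _ => Finset.sum_le_sum fun σ hσ => key i σ hσ
      _ = _ := by
          rw [Finset.sum_const, Finset.sum_const, Finset.card_univ, Fintype.card_fin, nsmul_eq_mul,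
            nsmul_eq_mul]
  -- `n · (n-1)! = n!`
  have hfac : (n : ℝ) * ((n - 1).factorial : ℝ) = (n.factorial : ℝ) := by
    have h := Nat.mul_factorial_pred (show n ≠ 0 by omega)
    exact_mod_cast h
  have htot : ((n.factorial : ℝ) * (X.card : ℝ)) * Real.log (X.card : ℝ) ≤
      ((n.factorial : ℝ) * (X.card : ℝ)) *
        (∑ i : Fin n, ∑ j : Fin n,
            Real.negMulLog (((X.filter (fun σ => σ i = j)).card : ℝ) / (X.card : ℝ)) +
          ((n : ℝ) - 1) * (4 * Real.sqrt η - 1)) := by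
    have h2 := hC.trans (add_le_add le_rfl hsum)
    have hrw : (n : ℝ) * ((X.card : ℝ) * (((n - 1).factorial : ℝ) *
        (((n : ℝ) - 1) * (4 * Real.sqrt η - 1)))) =
        ((n.factorial : ℝ) * (X.card : ℝ)) * (((n : ℝ) - 1) * (4 * Real.sqrt η - 1)) := by
      rw [← hfac]; ring
    rw [hrw, ← mul_add] at h2
    exact h2
  have hpos : (0 : ℝ) < (n.factorial : ℝ) * (X.card : ℝ) := mul_pos hF hN
  have hfin := le_of_mul_le_mul_left htot hpos
  have hring : ((n : ℝ) - 1) * (4 * Real.sqrt η - 1) =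
      -((n : ℝ) - 1) + ((n : ℝ) - 1) * (4 * Real.sqrt η) := by ring
  rw [hring] at hfin
  linarith

/-! ### The Cuckler–Kahn form: size plus Kullback–Leibler defect of the marginals -/

/-- `n log n − n ≤ log n!` (from `nⁿ/n! ≤ eⁿ`). [folklore] -/
theorem cast_mul_log_sub_le_log_factorial (n : ℕ) :
    (n : ℝ) * Real.log n - n ≤ Real.log (n.factorial : ℝ) := by
  rcases Nat.eq_zero_or_pos n with rfl | hn
  · simp
  have hn' : (0 : ℝ) < n := by exact_mod_cast hn
  have hF : (0 : ℝ) < n.factorial := by exact_mod_cast n.factorial_pos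
  have h : (n : ℝ) ^ n / (n.factorial : ℝ) ≤ Real.exp n := by
    first
      | exact Real.pow_div_factorial_le_exp hn'.le n
      | exact Real.pow_div_factorial_le_exp (n : ℝ) hn'.le n
  have h2 : (n : ℝ) ^ n ≤ Real.exp n * n.factorial := by
    rwa [div_le_iff₀ hF] at h
  have h3 := Real.log_le_log (by positivity) h2
  rw [Real.log_pow, Real.log_mul (Real.exp_pos _).ne' hF.ne', Real.log_exp] at h3
  linarith

/-- `4√η ≤ δ/2` for `η = min(1/2, (δ/8)²)`. [folklore] -/
theorem four_mul_sqrt_min_le {δ : ℝ} (hδ : 0 < δ) : 4 * Real.sqrt (min (1 / 2) ((δ / 8) ^ 2)) ≤ δ / 2 := by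
  have h1 : Real.sqrt (min (1 / 2) ((δ / 8) ^ 2)) ≤ Real.sqrt ((δ / 8) ^ 2) :=
    Real.sqrt_le_sqrt (min_le_right _ _)
  rw [Real.sqrt_sq (by positivity)] at h1
  linarith

/-- **Cuckler–Kahn for the uniform measure on a set of permutations, with Stirling folded in.**
For every `δ > 0` there are `η > 0` and `n₀` (namely `η = min(1/2, (δ/8)²)`, `n₀ = max 2 ⌈2/δ⌉`) such
that for all `n ≥ n₀` and every nonempty finite set `X` of permutations of `Fin n` all of whose
marginal probabilities `c i j / #X` are at most `η`:
`log #X + ∑_i (log n − ∑_j negMulLog (c i j / #X)) ≤ log n! + δ·n`.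
The bracket is the Kullback–Leibler divergence of the `i`-th marginal from the uniform distribution,
so this says: the total level-1 KL defect of `X` is paid for by `log n! − log #X` up to `δ n` — one nat
per row better than subadditivity of entropy. [cite: CucklerKahn2009, §1 (main theorem, bipartite case)] -/
theorem exists_spread_log_card_add_kl_le : ∀ δ : ℝ, 0 < δ → ∃ η : ℝ, 0 < η ∧ ∃ n₀ : ℕ, ∀ n ≥ n₀,
    ∀ X : Finset (Equiv.Perm (Fin n)), X.Nonempty →
      (∀ i j : Fin n, ((X.filter (fun σ => σ i = j)).card : ℝ) / (X.card : ℝ) ≤ η) →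
        Real.log (X.card : ℝ) +
            ∑ i : Fin n, (Real.log (n : ℝ) -
              ∑ j : Fin n, Real.negMulLog (((X.filter (fun σ => σ i = j)).card : ℝ) / (X.card : ℝ))) ≤
          Real.log (n.factorial : ℝ) + δ * n := by
  intro δ hδ
  refine ⟨min (1 / 2) ((δ / 8) ^ 2), lt_min (by norm_num) (by positivity), max 2 ⌈2 / δ⌉₊, ?_⟩
  intro n hn X hX hsp
  have hn2 : 2 ≤ n := le_of_max_le_left hn
  have hnδ : 2 / δ ≤ (n : ℝ) := (Nat.le_ceil _).trans (by exact_mod_cast le_of_max_le_right hn)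
  have hη1 : min (1 / 2 : ℝ) ((δ / 8) ^ 2) < 1 := lt_of_le_of_lt (min_le_left _ _) (by norm_num)
  have hE := log_card_le_sum_negMulLog_sub hn2 (lt_min (by norm_num) (by positivity)) hη1 X hX hsp
  have h4 := four_mul_sqrt_min_le hδ
  have hS := cast_mul_log_sub_le_log_factorial n
  rw [Finset.sum_sub_distrib, Finset.sum_const, Finset.card_univ, Fintype.card_fin, nsmul_eq_mul]
  have hn0 : (0 : ℝ) ≤ (n : ℝ) - 1 := by
    have : (2 : ℝ) ≤ n := by exact_mod_cast hn2
    linarith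
  have h1 : 1 ≤ δ / 2 * n := by
    have := (div_le_iff₀ hδ).1 hnδ
    linarith
  have h6 : ((n : ℝ) - 1) * (4 * Real.sqrt (min (1 / 2) ((δ / 8) ^ 2))) ≤ ((n : ℝ) - 1) * (δ / 2) :=
    mul_le_mul_of_nonneg_left h4 hn0
  linarith

end Literature.Combinatorics.Enumerative
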